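import Summits.BirchSwinnertonDyer.BirchSwinnertonDyer.Theorems.SignedLowerHalvesSmallImageLowerHalfBothSignsRttCharRoadCurveCharacter
import Literature.NumberTheory.GaloisRepresentations.LocalExistenceLubinTate
import HarnessLib

/-!
# Route `SignedLowerHalves`, crux L `SmallImageLowerHalfBothSigns` (item stmt-BirchSwinnertonDyer-23599), line `rtt_w3` v8 —
# row J-curve, the ASSEMBLY of the α-half from LEVELS: a tower of level maps `φ_n : 𝒪[K_v] → T` («`a ↦` the torsion point of
# `[a]_f λ_{n+1}`») with kernel `π^{n+1}`, tower-compatible up to units, exhausting `T`, and `χ_π`-equivariant, gives the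
# additive bijection `α : T ≃ K_v/𝒪_v` transporting `δ ∈ Γ_{K_v}` to `χ_π(δ)`

Width seat `bsd-line-slh-p3-w3` g16 under LEAD `cruxlead-stmt-BirchSwinnertonDyer-23599` (g5); helper
`--supports stmt-BirchSwinnertonDyer-23599`; THEOREMS ONLY, no `sorry`; closes nothing; BSD / crux L / JD / J-curve / E1 / E2 are
NOT proved by any of this.

WHY. After `…RttCharRoadCurveCharacter.lean` (`curveSide_of_alphaHalf`) the interface `hJcurve` of the J-glue
(`charRoadJD_of_curveSide`) is reduced to its α-half: an additive bijection
`α : (W.baseChange K)[p^∞] →+ K_v ⧸ 𝒪_v·1` with `α(δ·t) = χ_{−p}(δ)·α(t)`. The curve-side pieces [T1]/[T2] of row J (honda g18: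
`Ŵ = F_{[−p]}` p761420, the canonical Lubin–Tate isomorphism onto the standard group `F_f`, `f = πX + X^{q}`, evaluated on
`𝔪_E`-points; `W(E)[p^∞] ⊆ Ŵ(𝔪_E)` at a supersingular prime; the transport `K̄ → K̄_v`) naturally produce LEVEL DATA: for each `n`,
the map `φ_n : 𝒪[K_v] → T`, `a ↦` (the `p`-power torsion point matched with the division point `[a]_f λ_{n+1} ∈ K_π^{n+1}`), additive
(`[a+b]_f λ = [a]_f λ ⊕ [b]_f λ`), with kernel exactly `π^{n+1}𝒪` (`ltAct_genPt_eq_iff`), compatible in the tower up to the unit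
ambiguity of the chosen generators (`λ_{n+1} = [c_n]_f λ_{n+2}`, `exists_inclPt_genPt_eq`), jointly exhausting `T = W[p^∞]`, and
`Γ_{K_v}`-equivariant through `σ·[a]_f λ = [χ_π(σ)a]_f λ` (`absGal_smul_ltAct_lubinTateChar`). THIS file turns such level data into
the α-half, by pure algebra:

* §1 (any non-archimedean local field `F`, uniformiser `π`): `exists_coe_eq_pow_succ_mul` (every `x ∈ F` has `π^{n+1}x ∈ 𝒪` for
  some `n`), `not_pow_succ_dvd_pow`, `isUnit_of_not_dvd` (`𝒪` is local with maximal ideal `(π)`),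
  ★ `exists_strict_levels_of_levels` — NORMALISATION: weak tower data (`∀ n, ∃ c, ∀ a, φ_n(a) = φ_{n+1}(c·a)`) with kernels
  `π^{n+1}` can be re-based by units to STRICT data `ψ_{n+1}(π·a) = ψ_n(a)` (the `c_n` are `π`·unit), keeping kernels, exhaustion
  and equivariance (for any family of "scalars" commuting with the units — here `χ_π(δ)`).
* §2 ★ `exists_divisibleHom_of_strict_levels` — from strict data, the additive map `β : F →+ T`, `β(x) = ψ_n(π^{n+1}x)` (any
  admissible `n`), with `β(x) = ψ_n(a)` whenever `a = π^{n+1}x`.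
* §3 (`F = K_v`) ★★ `exists_alpha_of_levels` — **the α-half of `hJcurve` from level data**: `∃ α : T →+ K_v ⧸ 𝒪_v·1`,
  bijective, with `α(act δ t) = e_v(χ_π(δ)) • α(t)` (`e_v = integerEquivAdicCompletionIntegers`, the scalar of
  `curveSide_of_alphaHalf`); `act : Γ_{K_v} → T → T` is ANY action function (for row J: `δ ↦ (resGalOfEmb (closureEmb K_v) δ • ·)`
  on `(W.baseChange K).geomPrimaryTorsion p`), no axiom on it is needed since the `φ_n` exhaust `T`.

References: [LubinTate1965] Thm. 2 and Cor. (`F_f[π^{n}] ≅ 𝒪/π^{n}`, `F_f[π^∞] ≅ F/𝒪`); [CasselsFrohlichANT1967] Ch. VI §3.6 Prop. 6;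
[Kobayashi2003] §8 (proof of Thm. 8.4); [KimPark2017] §2.2 Prop. 2.5.
-/

set_option autoImplicit false
-- D-0017: single-problem summit, the namespace repeats the problem name by design.
set_option linter.dupNamespace false
noncomputable section

open scoped NumberField
open NumberField IsDedekindDomain Field
  Literature.NumberTheory.GaloisRepresentations

namespace Summit.BirchSwinnertonDyer.BirchSwinnertonDyer.Theorems.SmallImageRttCharRoad

/-! ## §1 Local algebra in `𝒪[F]` and the normalisation of level data -/

section Levels

open ValuativeRel Literature.NumberTheory.GaloisRepresentations.IsNonarchimedeanLocalField

variable {F : Type} [Field F] [ValuativeRel F] [TopologicalSpace F] [IsNonarchimedeanLocalField F]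
variable {π : 𝒪[F]} (hπ : (valuation F).IsUniformizer (π : F))

include hπ in
/-- Every `x ∈ F` becomes integral after multiplication by a power of the uniformiser: `π^{n+1}·x ∈ 𝒪` for some `n`
(the valuation is discrete: `v(x) = v(π)^k`). [cite: SerreLocalFields1979, Ch. II §1] -/
theorem exists_coe_eq_pow_succ_mul (x : F) : ∃ (n : ℕ) (a : 𝒪[F]), (a : F) = (π : F) ^ (n + 1) * x := by
  by_cases hx : x = 0
  · exact ⟨0, 0, by rw [hx, mul_zero]; rfl⟩
  obtain ⟨k, hk⟩ := exists_valuation_eq_unifValue_zpow F hx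
  have hπv : valuation F (π : F) = unifValue F := (isUniformizer_iff_valuation_eq_unifValue F (π : F)).mp hπ
  refine ⟨k.natAbs, ⟨(π : F) ^ (k.natAbs + 1) * x, ?_⟩, rfl⟩
  rw [Valuation.mem_integer_iff, map_mul, map_pow, hπv, hk, ← zpow_natCast, ← zpow_add₀ (unifValue_ne_zero F)]
  have hnn : (0 : ℤ) ≤ ((k.natAbs + 1 : ℕ) : ℤ) + k := by omega
  obtain ⟨m, hm⟩ := Int.eq_ofNat_of_zero_le hnn
  rw [hm, zpow_natCast]
  exact pow_le_one₀ zero_le (unifValue_lt_one F).le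

include hπ in
/-- `π^{n+1} ∤ π^{n}` in `𝒪[F]` (`π` is not a unit). [folklore] -/
theorem not_pow_succ_dvd_pow (n : ℕ) : ¬ π ^ (n + 1) ∣ π ^ n := by
  intro h
  have hπ0 : (π : 𝒪[F]) ≠ 0 := fun h0 => hπ.ne_zero (by rw [h0]; rfl)
  rw [pow_succ] at h
  have h1 : π ∣ 1 := by
    obtain ⟨d, hd⟩ := h
    refine ⟨d, mul_left_cancel₀ (pow_ne_zero n hπ0) ?_⟩
    rw [mul_one, ← mul_assoc]; exact hd
  exact hπ.not_isUnit (isUnit_of_dvd_one h1)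

include hπ in
/-- An element of `𝒪[F]` not divisible by `π` is a unit (`𝒪[F]` is local with maximal ideal `(π)`). [cite: SerreLocalFields1979, Ch. II §1] -/
theorem isUnit_of_not_dvd {d : 𝒪[F]} (hd : ¬ π ∣ d) : IsUnit d := by
  by_contra hu
  apply hd
  have hmem : d ∈ 𝓂[F] := (IsLocalRing.mem_maximalIdeal d).mpr hu
  rw [maximalIdeal_eq_span_singleton hπ, Ideal.mem_span_singleton] at hmem
  exact hmem

include hπ in
/-- In weak tower data the transition scalar is `π` times a unit: if `φ_n` has kernel exactly `π^{n+1}𝒪`, `φ_{n+1}` has kernel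
exactly `π^{n+2}𝒪`, and `φ_n(a) = φ_{n+1}(c·a)` for all `a`, then `c = π·u` with `u` a unit (`λ_{n+1} = [c]λ_{n+2}` forces
`π ∣ c`, `π² ∤ c`). [cite: CasselsFrohlichANT1967, Ch. VI §3.6 Prop. 6 (a)] -/
theorem exists_unit_eq_mul_of_levels {T : Type*} [AddCommGroup T] {φ φ' : 𝒪[F] →+ T} {n : ℕ}
    (hker : ∀ a, φ a = 0 ↔ π ^ (n + 1) ∣ a) (hker' : ∀ a, φ' a = 0 ↔ π ^ (n + 2) ∣ a) {c : 𝒪[F]}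
    (hc : ∀ a, φ a = φ' (c * a)) : ∃ u : (𝒪[F])ˣ, c = π * u := by
  have hπ0 : (π : 𝒪[F]) ≠ 0 := fun h0 => hπ.ne_zero (by rw [h0]; rfl)
  -- `π ∣ c`
  have h1 : π ^ (n + 2) ∣ c * π ^ (n + 1) := by
    rw [← hker', ← hc, hker]
  have hπc : π ∣ c := by
    obtain ⟨d, hd⟩ := h1
    refine ⟨d, mul_right_cancel₀ (pow_ne_zero (n + 1) hπ0) ?_⟩
    rw [hd]; ring
  obtain ⟨d, rfl⟩ := hπc
  -- `π ∤ d`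
  have h2 : ¬ π ^ (n + 2) ∣ π * d * π ^ n := by
    rw [← hker', ← hc, hker]
    exact not_pow_succ_dvd_pow hπ n
  have hd : ¬ π ∣ d := by
    rintro ⟨d', rfl⟩
    apply h2
    exact ⟨d', by ring⟩
  obtain ⟨u, hu⟩ := isUnit_of_not_dvd hπ hd
  exact ⟨u, by rw [hu]⟩

include hπ in
/-- ★ **Normalisation of level data.** Weak tower data `φ_n : 𝒪[F] →+ T` (kernel exactly `π^{n+1}`, `φ_n = φ_{n+1}(c_n·)` for SOME
`c_n`, exhausting `T`, equivariant for a family of scalars `s δ ∈ 𝒪[F]` w.r.t. an action function `act`) can be replaced by STRICT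
data `ψ_n = φ_n(w_n ·)` (`w_n` units, `w_0 = 1`, `w_{n+1} = u_n w_n` where `c_n = π u_n`) with `ψ_{n+1}(π·a) = ψ_n(a)`, the same
kernels, exhaustion and equivariance. [cite: CasselsFrohlichANT1967, Ch. VI §3.6 Prop. 6] [cite: LubinTate1965, Thm. 2] -/
theorem exists_strict_levels_of_levels {T : Type*} [AddCommGroup T] {G : Type*} (act : G → T → T) (s : G → 𝒪[F])
    (φ : ℕ → (𝒪[F] →+ T)) (hker : ∀ n a, φ n a = 0 ↔ π ^ (n + 1) ∣ a)
    (hcompat : ∀ n, ∃ c : 𝒪[F], ∀ a, φ n a = φ (n + 1) (c * a)) (hsurj : ∀ t : T, ∃ (n : ℕ) (a : 𝒪[F]), φ n a = t)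
    (hequiv : ∀ n (δ : G) a, φ n (s δ * a) = act δ (φ n a)) :
    ∃ ψ : ℕ → (𝒪[F] →+ T), (∀ n a, ψ n a = 0 ↔ π ^ (n + 1) ∣ a) ∧ (∀ n a, ψ (n + 1) (π * a) = ψ n a) ∧
      (∀ t : T, ∃ (n : ℕ) (a : 𝒪[F]), ψ n a = t) ∧ (∀ n (δ : G) a, ψ n (s δ * a) = act δ (ψ n a)) := by
  choose c hc using hcompat
  have hu : ∀ n, ∃ u : (𝒪[F])ˣ, c n = π * u := fun n =>
    exists_unit_eq_mul_of_levels hπ (hker n) (by simpa using hker (n + 1)) (hc n)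
  choose u hu using hu
  -- the correcting units `w_n`
  let w : ℕ → (𝒪[F])ˣ := fun n => Nat.rec 1 (fun k wk => u k * wk) n
  have hw0 : w 0 = 1 := rfl
  have hwS : ∀ n, w (n + 1) = u n * w n := fun n => rfl
  let ψ : ℕ → (𝒪[F] →+ T) := fun n => (φ n).comp (AddMonoidHom.mulLeft (w n).val)
  have hψ : ∀ n a, ψ n a = φ n ((w n).val * a) := fun n a => rfl
  refine ⟨ψ, fun n a => ?_, fun n a => ?_, fun t => ?_, fun n δ a => ?_⟩
  · rw [hψ, hker]
    exact ⟨fun h => (Units.dvd_mul_left).mp h, fun h => (Units.dvd_mul_left).mpr h⟩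
  · rw [hψ, hψ, hc n, hu n, hwS, Units.val_mul]
    congr 1
    ring
  · obtain ⟨n, a, ha⟩ := hsurj t
    refine ⟨n, ((w n)⁻¹ : (𝒪[F])ˣ) * a, ?_⟩
    rw [hψ, ← mul_assoc, Units.mul_inv, one_mul, ha]
  · rw [hψ, hψ, ← hequiv n δ, ← mul_assoc, ← mul_assoc, mul_comm (s δ)]

/-! ## §2 The divisible hull map `β : F →+ T` of strict level data -/

omit [TopologicalSpace F] [IsNonarchimedeanLocalField F] in
/-- For strict data, the value `ψ_n(a)` only depends on `x = a/π^{n+1} ∈ F`: if `a = π^{n+1}x` and `b = π^{m+1}x` then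
`ψ_n(a) = ψ_m(b)`. [cite: LubinTate1965, Thm. 2 Cor.] -/
theorem levels_eq_of_coe_eq {T : Type*} [AddCommGroup T] (ψ : ℕ → (𝒪[F] →+ T))
    (hstrict : ∀ n a, ψ (n + 1) (π * a) = ψ n a) {n m : ℕ} {a b : 𝒪[F]} {x : F}
    (ha : (a : F) = (π : F) ^ (n + 1) * x) (hb : (b : F) = (π : F) ^ (m + 1) * x) : ψ n a = ψ m b := by
  -- iterate strictness: `ψ_{n+k}(π^k a) = ψ_n(a)`
  have iter : ∀ (k n : ℕ) (a : 𝒪[F]), ψ (n + k) (π ^ k * a) = ψ n a := by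
    intro k
    induction k with
    | zero => intro n a; rw [pow_zero, one_mul, Nat.add_zero]
    | succ k ih => intro n a; rw [← Nat.add_assoc, pow_succ, mul_comm (π ^ k) π, mul_assoc, hstrict, ih]
  rcases le_total n m with hnm | hmn
  · obtain ⟨k, rfl⟩ := Nat.exists_eq_add_of_le hnm
    have hba : b = π ^ k * a := by
      apply Subtype.ext
      push_cast
      rw [ha, hb, ← mul_assoc, ← pow_add]
      congr 2; omega
    rw [hba, iter]
  · obtain ⟨k, rfl⟩ := Nat.exists_eq_add_of_le hmn
    have hab : a = π ^ k * b := by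
      apply Subtype.ext
      push_cast
      rw [ha, hb, ← mul_assoc, ← pow_add]
      congr 2; omega
    rw [hab, iter]

include hπ in
/-- ★ **The divisible hull map of strict level data**: an additive `β : F →+ T` with `β(x) = ψ_n(a)` whenever `a = π^{n+1}x ∈ 𝒪`
(so `β(a/π^{n+1}) = ψ_n(a)`: «`a/π^{n+1} mod 𝒪 ↦` the torsion point of `[a]_f λ_{n+1}`»). [cite: LubinTate1965, Thm. 2 Cor.]
[cite: CasselsFrohlichANT1967, Ch. VI §3.6 Prop. 6] -/
theorem exists_divisibleHom_of_strict_levels {T : Type*} [AddCommGroup T] (ψ : ℕ → (𝒪[F] →+ T))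
    (hstrict : ∀ n a, ψ (n + 1) (π * a) = ψ n a) :
    ∃ β : F →+ T, ∀ (n : ℕ) (a : 𝒪[F]) (x : F), (a : F) = (π : F) ^ (n + 1) * x → β x = ψ n a := by
  choose N A hA using exists_coe_eq_pow_succ_mul hπ
  have key : ∀ (n : ℕ) (a : 𝒪[F]) (x : F), (a : F) = (π : F) ^ (n + 1) * x → ψ (N x) (A x) = ψ n a :=
    fun n a x ha => levels_eq_of_coe_eq ψ hstrict (hA x) ha
  refine ⟨AddMonoidHom.mk' (fun x => ψ (N x) (A x)) fun x y => ?_, fun n a x ha => key n a x ha⟩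
  -- additivity: evaluate all three at the common level `N x + N y + 1`
  set M := N x + N y + 1 with hM
  obtain ⟨kx, hkx⟩ : ∃ k, M = N x + k := ⟨N y + 1, by omega⟩
  obtain ⟨ky, hky⟩ : ∃ k, M = N y + k := ⟨N x + 1, by omega⟩
  have hax : (((π ^ kx * A x : 𝒪[F])) : F) = (π : F) ^ (M + 1) * x := by
    push_cast; rw [hA x, ← mul_assoc, ← pow_add]; congr 2; omega
  have hay : (((π ^ ky * A y : 𝒪[F])) : F) = (π : F) ^ (M + 1) * y := by
    push_cast; rw [hA y, ← mul_assoc, ← pow_add]; congr 2; omega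
  have haxy : (((π ^ kx * A x + π ^ ky * A y : 𝒪[F])) : F) = (π : F) ^ (M + 1) * (x + y) := by
    rw [AddMemClass.coe_add, hax, hay, mul_add]
  show ψ (N (x + y)) (A (x + y)) = ψ (N x) (A x) + ψ (N y) (A y)
  rw [key M _ _ haxy, key M _ _ hax, key M _ _ hay, map_add]

end Levels

/-! ## §3 ★★ The α-half of `hJcurve` from level data (`F = K_v`) -/

section Alpha

open ValuativeRel IsDedekindDomain.HeightOneSpectrum Literature.NumberTheory.NumberFields
  Literature.NumberTheory.GaloisRepresentations.IsNonarchimedeanLocalField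

variable {K : Type} [Field K] [NumberField K] (v : HeightOneSpectrum (𝓞 K))

/-- Membership in `𝒪_v·1 ⊆ K_v` is membership in the valuation ring `𝒪[K_v]`. [folklore] -/
theorem mem_span_one_iff (x : v.adicCompletion K) :
    x ∈ Submodule.span (v.adicCompletionIntegers K) {(1 : v.adicCompletion K)} ↔ x ∈ 𝒪[v.adicCompletion K] := by
  rw [Submodule.mem_span_singleton]
  constructor
  · rintro ⟨c, rfl⟩
    rw [Algebra.smul_def, mul_one]
    exact (mem_integer_iff_mem_adicCompletionIntegers v _).mpr c.2
  · intro hx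
    refine ⟨⟨x, (mem_integer_iff_mem_adicCompletionIntegers v _).mp hx⟩, ?_⟩
    rw [Algebra.smul_def, mul_one]
    rfl

/-- ★★ **The α-half of `hJcurve` from level data.** Let `T` be an additive group with an action function `act` of
`Γ_{K_v}`, `π ∈ 𝒪[K_v]` a uniformiser with Lubin–Tate character `χ_π`, and `φ_n : 𝒪[K_v] →+ T` (`n ≥ 0`) level maps with
(i) `φ_n(a) = 0 ↔ π^{n+1} ∣ a`, (ii) `∀ n ∃ c ∀ a, φ_n(a) = φ_{n+1}(c·a)` (tower compatibility up to the generator ambiguity),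
(iii) every `t ∈ T` is some `φ_n(a)`, (iv) `φ_n(χ_π(δ)·a) = act δ (φ_n a)`. Then there is an additive BIJECTION
`α : T → K_v ⧸ 𝒪_v·1` with `α(act δ t) = e_v(χ_π(δ)) • α(t)` — for `T = (W.baseChange K)[p^∞]`, `act δ = (resGalOfEmb (closureEmb K_v) δ • ·)`
and `π = −p` this is EXACTLY the hypothesis of `curveSide_of_alphaHalf`, hence `hJcurve` and (J-glue) `hJD`. Construction: normalise
(§1), `β : K_v →+ T` (§2) has kernel `𝒪` by (i), is onto by (iii), and `β(χ_π(δ)x) = act δ (β x)` by (iv); `α` = the inverse of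
`K_v/𝒪 ≅ T` read through any section of `β`. [cite: LubinTate1965, Thm. 2 and Cor.] [cite: CasselsFrohlichANT1967, Ch. VI §3.6 Prop. 6]
[cite: Kobayashi2003, §8 (proof of Thm. 8.4)] -/
theorem exists_alpha_of_levels {T : Type*} [AddCommGroup T]
    (act : absoluteGaloisGroup (v.adicCompletion K) → T → T)
    {π : 𝒪[v.adicCompletion K]} (hπ : (valuation (v.adicCompletion K)).IsUniformizer (π : v.adicCompletion K))
    (φ : ℕ → (𝒪[v.adicCompletion K] →+ T)) (hker : ∀ n a, φ n a = 0 ↔ π ^ (n + 1) ∣ a)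
    (hcompat : ∀ n, ∃ c : 𝒪[v.adicCompletion K], ∀ a, φ n a = φ (n + 1) (c * a))
    (hsurj : ∀ t : T, ∃ (n : ℕ) (a : 𝒪[v.adicCompletion K]), φ n a = t)
    (hequiv : ∀ n (δ : absoluteGaloisGroup (v.adicCompletion K)) a,
      φ n ((lubinTateChar hπ δ : (𝒪[v.adicCompletion K])ˣ) * a) = act δ (φ n a)) :
    ∃ α : T →+ (v.adicCompletion K ⧸ Submodule.span (v.adicCompletionIntegers K) {(1 : v.adicCompletion K)}),
      Function.Bijective α ∧
      ∀ (δ : absoluteGaloisGroup (v.adicCompletion K)) (t : T),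
        α (act δ t) = integerEquivAdicCompletionIntegers v
          ((lubinTateChar hπ δ : (𝒪[v.adicCompletion K])ˣ) : 𝒪[v.adicCompletion K]) • α t := by
  -- strict data and the hull map
  obtain ⟨ψ, hkerψ, hstrict, hsurjψ, hequivψ⟩ := exists_strict_levels_of_levels hπ act
    (fun δ => ((lubinTateChar hπ δ : (𝒪[v.adicCompletion K])ˣ) : 𝒪[v.adicCompletion K])) φ hker hcompat hsurj hequiv
  obtain ⟨β, hβ⟩ := exists_divisibleHom_of_strict_levels hπ ψ hstrict
  have hπ0 : ((π : 𝒪[v.adicCompletion K]) : v.adicCompletion K) ≠ 0 := hπ.ne_zero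
  set O₁ := Submodule.span (v.adicCompletionIntegers K) {(1 : v.adicCompletion K)} with hO₁
  -- kernel of `β` is `𝒪`
  have hβker : ∀ x, β x = 0 ↔ x ∈ 𝒪[v.adicCompletion K] := by
    intro x
    obtain ⟨n, a, ha⟩ := exists_coe_eq_pow_succ_mul hπ x
    rw [hβ n a x ha, hkerψ]
    constructor
    · rintro ⟨d, rfl⟩
      have hx : x = (d : v.adicCompletion K) := by
        have h := ha; push_cast at h
        exact (mul_left_cancel₀ (pow_ne_zero (n + 1) hπ0) h.symm)
      rw [hx]; exact d.2
    · intro hx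
      refine ⟨⟨x, hx⟩, Subtype.ext ?_⟩
      push_cast; rw [ha]
  -- `β` is onto
  have hβsurj : Function.Surjective β := by
    intro t
    obtain ⟨n, a, rfl⟩ := hsurjψ t
    refine ⟨(a : v.adicCompletion K) * ((π : v.adicCompletion K) ^ (n + 1))⁻¹, hβ n a _ ?_⟩
    rw [mul_comm, mul_assoc, inv_mul_cancel₀ (pow_ne_zero (n + 1) hπ0), mul_one]
  -- `β` is `χ_π`-equivariant
  have hβequiv : ∀ (δ : absoluteGaloisGroup (v.adicCompletion K)) (x : v.adicCompletion K),
      β ((((lubinTateChar hπ δ : (𝒪[v.adicCompletion K])ˣ) : 𝒪[v.adicCompletion K]) : v.adicCompletion K) * x) =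
        act δ (β x) := by
    intro δ x
    obtain ⟨n, a, ha⟩ := exists_coe_eq_pow_succ_mul hπ x
    have ha' : ((((lubinTateChar hπ δ : (𝒪[v.adicCompletion K])ˣ) : 𝒪[v.adicCompletion K]) * a :
        𝒪[v.adicCompletion K]) : v.adicCompletion K) =
        (π : v.adicCompletion K) ^ (n + 1) *
          ((((lubinTateChar hπ δ : (𝒪[v.adicCompletion K])ˣ) : 𝒪[v.adicCompletion K]) : v.adicCompletion K) * x) := by
      push_cast; rw [ha]; ring
    rw [hβ n _ _ ha', hβ n a x ha, hequivψ]
  -- a section of `β` and the map `α`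
  obtain ⟨s, hs⟩ := hβsurj.hasRightInverse
  have hdiff : ∀ x y, β x = β y → (Submodule.Quotient.mk x : v.adicCompletion K ⧸ O₁) = Submodule.Quotient.mk y := by
    intro x y hxy
    rw [Submodule.Quotient.eq, mem_span_one_iff, ← hβker, map_sub, hxy, sub_self]
  let α : T →+ (v.adicCompletion K ⧸ O₁) := AddMonoidHom.mk' (fun t => Submodule.Quotient.mk (s t)) fun t t' => by
    show (Submodule.Quotient.mk (s (t + t')) : v.adicCompletion K ⧸ O₁) = Submodule.Quotient.mk (s t) + Submodule.Quotient.mk (s t')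
    rw [← Submodule.Quotient.mk_add]
    exact hdiff _ _ (by rw [hs, map_add, hs, hs])
  have hα : ∀ t, α t = Submodule.Quotient.mk (s t) := fun t => rfl
  have hαβ : ∀ x, α (β x) = Submodule.Quotient.mk x := fun x => by rw [hα]; exact hdiff _ _ (hs _)
  refine ⟨α, ⟨?_, ?_⟩, fun δ t => ?_⟩
  · -- injective
    refine (injective_iff_map_eq_zero α).mpr fun t ht => ?_
    rw [hα, Submodule.Quotient.mk_eq_zero, mem_span_one_iff, ← hβker, hs] at ht
    exact ht
  · -- surjective
    intro q
    obtain ⟨x, rfl⟩ := Submodule.Quotient.mk_surjective O₁ q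
    exact ⟨β x, hαβ x⟩
  · -- equivariance
    obtain ⟨x, rfl⟩ := hβsurj t
    rw [← hβequiv, hαβ, hαβ, ← Submodule.Quotient.mk_smul, Algebra.smul_def]
    rfl

end Alpha

end Summit.BirchSwinnertonDyer.BirchSwinnertonDyer.Theorems.SmallImageRttCharRoad

end
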